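import Summits.ABC.ABC.Theses.FeketeScales
import Summits.ABC.ABC.Theorems.FeketeScalesSubmultOfRST
import Summits.ABC.ABC.Theorems.FeketeScalesSubmultOfRSTBridge
import Summits.ABC.ABC.Theorems.FeketeScalesTargetOfSubPowerSlack
import Summits.ABC.ABC.Theorems.FeketeScalesPolynomialAbcOfSubmult
import Summits.ABC.ABC.Theorems.FeketeScalesScaleSubmultiplicativityEnvelopeWitnessesFloor
import Summits.ABC.ABC.Theorems.FeketeScalesScaleSubmultiplicativityNapIteration
import Summits.ABC.ABC.Theorems.FeketeScalesScaleSubmultiplicativityOfEnvelopeOfPowerShapes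

/-!
# Strategist r1 companion — crux stmt-ABC-2160 `ScaleSubmultiplicativity` (route `FeketeScales`)

Crux-strategist REDIRECT seat r1 (planner-cstrat-stmt-ABC-2160-r1-0, 2026-08-17), second opinion after the
`no-strategy-short-of-summit` censuses of seats p1 and s1 (`STRATEGY-CENSUS.md`).  This file is the KERNEL part of
the r1 census: it puts in one place the theorem that makes the crux summit-strength for the pre-birth tribunal
(D-0033, T1 rule (a) DOMINATING HYPOTHESIS), and proves that the same certificate covers the WHOLE technique class
of the route (every slack the Fekete assembly can use), so that no re-target inside the class escapes it.

## §1  The slack family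

For a slack function `s : ℝ → ℝ` of `L = log(R₁R₂)` put
* `CruxSlack s`      — the crux with `exp(s L)` in place of `exp(L^θ)` (`ScaleSubmultiplicativity ↔ ∃ θ < 1,
  CruxSlack (·^θ)`, `scaleSubmultiplicativity_iff`);
* `PointwiseSlack s` — its pointwise DOMINATOR `H_s : c ≤ K · rad · exp(s(log rad))` for every abc triple;
* `Sublinear s` (`s(L) = o(L)`), `LinearlyLarge s` (`s(L) ≥ εL` eventually), `FeketeAdmissible s` (the relative
  loss `s(2^i t₀)/(2^i t₀) → 0` along a doubling chain — implied by the SUMMABLE loss the Assembly actually needs,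
  `feketeAdmissible_of_summableLoss`).

## §2  Three zones (all proved here or re-exported from `Theorems/`)

* ZONE I  (`LinearlyLarge s`):  `ABC → CruxSlack s` (`cruxSlack_of_abc_of_linearlyLarge`): the crux with linear
  slack is a CONSEQUENCE of the summit — and useless for a Fekete iteration (loss not summable; zones I and II are
  disjoint, `not_sublinear_of_linearlyLarge`).
* ZONE II (`FeketeAdmissible s`, `s` monotone on `[0,∞)`):  `H_s → CruxSlack s` (`cruxSlack_of_pointwiseSlack`, dyadic
  witnesses) AND `H_s → ABC` (`abc_of_pointwiseSlack_of_sublinear` with `sublinear_of_feketeAdmissible`):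
  `family_dominated`.  So EVERY member of the class the route can use is dominated, in the sense of T1 rule (a), by a
  pointwise hypothesis that alone gives the summit; for `s = L^θ`, `θ ∈ (1/2, 1)`, that hypothesis is implied by
  Robert–Stewart–Tenenbaum's Conjecture A (upper half) — `ruleA_rst`, `ruleA_subPower` re-export the landed pair.
* ZONE III (`s = L^θ`, `θ < 1/2`): the dominator is FALSE (`zoneIII_dominator_false`, Stewart–Tijdeman, landed
  `not_subpowerSlack_of_lt_half`); there the crux is undominated but model-undetermined (s1 census S9) — recorded in
  the census as the one escape from rule (a) inside the class, and why it is not a re-target.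

## §3  Consequences for the re-cut proposed by s1 (R4)

`ruleA_nap`: `RSTConjectureAUpper → NAP` (through the crux), so the NAP re-cut is dominated by the same `H` and would
be born summit-strength by the same certificate.

Nothing here is a new arithmetic input; every theorem is elementary real analysis over `IsABCTriple`/`rad` plus the
landed items of the route.  `lean check`: see the census front matter.
-/

-- `Summit.<Summit>.<Problem>` is the mandated summit-side namespace (CONVENTIONS §2).
set_option linter.dupNamespace false

namespace Summit.ABC.ABC.Cruxes.ScaleSubmultiplicativity.StrategistR1

open Literature.NumberTheory.DiophantineGeometry
open Summit.ABC.ABC.Theses.FeketeScales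
open Summit.ABC.ABC.Theorems
open Filter Topology

/-! ## §1  The slack family -/

/-- The crux with a general slack `s(L)`, `L = log(R₁R₂)`, in place of `L^θ`. -/
def CruxSlack (s : ℝ → ℝ) : Prop :=
  ∃ K : ℝ, 0 < K ∧ ∃ R₀ : ℕ, ∀ R₁ R₂ : ℕ, R₀ ≤ R₁ → R₀ ≤ R₂ → ∀ a b c : ℕ,
    IsABCTriple a b c → rad a b c ≤ R₁ * R₂ → ∃ a₁ b₁ c₁ a₂ b₂ c₂ : ℕ, IsABCTriple a₁ b₁ c₁ ∧
      rad a₁ b₁ c₁ ≤ R₁ ∧ IsABCTriple a₂ b₂ c₂ ∧ rad a₂ b₂ c₂ ≤ R₂ ∧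
      (c : ℝ) ≤ K * Real.exp (s (Real.log ((R₁ : ℝ) * R₂))) * c₁ * c₂

/-- The pointwise DOMINATOR `H_s`: `c ≤ K · rad · exp(s(log rad))` for every abc triple. -/
def PointwiseSlack (s : ℝ → ℝ) : Prop :=
  ∃ K : ℝ, 0 < K ∧ ∀ a b c : ℕ, IsABCTriple a b c →
    (c : ℝ) ≤ K * ((rad a b c : ℕ) : ℝ) * Real.exp (s (Real.log ((rad a b c : ℕ) : ℝ)))

/-- `s(L) = o(L)`. -/
def Sublinear (s : ℝ → ℝ) : Prop :=
  ∀ ε : ℝ, 0 < ε → ∃ L₀ : ℝ, ∀ L : ℝ, L₀ ≤ L → s L ≤ ε * L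

/-- `s(L) ≥ ε L` eventually, for some `ε > 0`. -/
def LinearlyLarge (s : ℝ → ℝ) : Prop :=
  ∃ ε : ℝ, 0 < ε ∧ ∃ L₀ : ℝ, ∀ L : ℝ, L₀ ≤ L → ε * L ≤ s L

/-- Fekete-admissibility, weakest form: along a doubling chain `tᵢ = 2^i t₀` the relative loss tends to `0`. -/
def FeketeAdmissible (s : ℝ → ℝ) : Prop :=
  ∃ t₀ : ℝ, 0 < t₀ ∧ Tendsto (fun i : ℕ => s (2 ^ i * t₀) / (2 ^ i * t₀)) atTop (𝓝 0)

/-- What the Assembly's doubling argument actually consumes: SUMMABLE relative loss along a doubling chain. -/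
def SummableLoss (s : ℝ → ℝ) : Prop :=
  ∃ t₀ : ℝ, 0 < t₀ ∧ Summable (fun i : ℕ => s (2 ^ i * t₀) / (2 ^ i * t₀))

/-- Summable loss ⟹ Fekete-admissible (terms of a summable series tend to zero). [folklore] -/
theorem feketeAdmissible_of_summableLoss {s : ℝ → ℝ} (h : SummableLoss s) : FeketeAdmissible s := by
  obtain ⟨t₀, ht₀, hs⟩ := h
  exact ⟨t₀, ht₀, hs.tendsto_atTop_zero⟩

/-- The filed crux is the member `s = L^θ`, `θ < 1`, of the family (definitional). [folklore] -/
theorem scaleSubmultiplicativity_iff :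
    ScaleSubmultiplicativity ↔ ∃ θ : ℝ, θ < 1 ∧ CruxSlack (fun L : ℝ => L ^ θ) :=
  ⟨fun ⟨θ, hθ, h⟩ => ⟨θ, hθ, h⟩, fun ⟨θ, hθ, h⟩ => ⟨θ, hθ, h⟩⟩

/-! ## §2  Zone II: the dominator gives the crux (dyadic witnesses) and, when sublinear, the summit -/

/-- `H_s ⟹ CruxSlack s` for every slack `s` monotone on `[0, ∞)`: the witnesses are `(1, 2ⁿ - 1, 2ⁿ)` at both
scales (`cᵢ > Rᵢ/4`), exactly as in the landed `submultOfRST_proof`. [folklore] -/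
theorem cruxSlack_of_pointwiseSlack {s : ℝ → ℝ} (hs : MonotoneOn s (Set.Ici 0)) (h : PointwiseSlack s) :
    CruxSlack s := by
  obtain ⟨K, hK, h⟩ := h
  refine ⟨16 * K, by positivity, 4, ?_⟩
  intro R₁ R₂ hR₁ hR₂ a b c habc hrad
  obtain ⟨a₁, b₁, c₁, h₁, hrad₁, hc₁⟩ := SubmultOfRST.exists_triple_at_scale hR₁
  obtain ⟨a₂, b₂, c₂, h₂, hrad₂, hc₂⟩ := SubmultOfRST.exists_triple_at_scale hR₂
  refine ⟨a₁, b₁, c₁, a₂, b₂, c₂, h₁, hrad₁, h₂, hrad₂, ?_⟩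
  have hP16 : R₁ * R₂ < 16 * (c₁ * c₂) := by
    calc R₁ * R₂ < (4 * c₁) * (4 * c₂) := Nat.mul_lt_mul'' hc₁ hc₂
      _ = 16 * (c₁ * c₂) := by ring
  have hP16r : ((R₁ : ℝ) * R₂) ≤ 16 * ((c₁ : ℝ) * c₂) := by exact_mod_cast hP16.le
  have hrad2 : (2 : ℝ) ≤ ((rad a b c : ℕ) : ℝ) := by exact_mod_cast SubmultOfRST.two_le_rad habc
  have hrad0 : (0 : ℝ) < ((rad a b c : ℕ) : ℝ) := by linarith
  have hradP : ((rad a b c : ℕ) : ℝ) ≤ (R₁ : ℝ) * R₂ := by exact_mod_cast hrad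
  have hlog0 : 0 ≤ Real.log ((rad a b c : ℕ) : ℝ) := Real.log_nonneg (by linarith)
  have hlog : Real.log ((rad a b c : ℕ) : ℝ) ≤ Real.log ((R₁ : ℝ) * R₂) := Real.log_le_log hrad0 hradP
  have hexp : Real.exp (s (Real.log ((rad a b c : ℕ) : ℝ))) ≤ Real.exp (s (Real.log ((R₁ : ℝ) * R₂))) :=
    Real.exp_le_exp.mpr (hs (Set.mem_Ici.mpr hlog0) (Set.mem_Ici.mpr (hlog0.trans hlog)) hlog)
  have hE0 : 0 ≤ Real.exp (s (Real.log ((R₁ : ℝ) * R₂))) := (Real.exp_pos _).le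
  have hKR : 0 ≤ K * ((R₁ : ℝ) * R₂) := by positivity
  calc (c : ℝ) ≤ K * ((rad a b c : ℕ) : ℝ) * Real.exp (s (Real.log ((rad a b c : ℕ) : ℝ))) := h a b c habc
    _ ≤ K * ((R₁ : ℝ) * R₂) * Real.exp (s (Real.log ((R₁ : ℝ) * R₂))) :=
        mul_le_mul (mul_le_mul_of_nonneg_left hradP hK.le) hexp (Real.exp_pos _).le hKR
    _ ≤ K * (16 * ((c₁ : ℝ) * c₂)) * Real.exp (s (Real.log ((R₁ : ℝ) * R₂))) :=
        mul_le_mul_of_nonneg_right (mul_le_mul_of_nonneg_left hP16r hK.le) hE0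
    _ = 16 * K * Real.exp (s (Real.log ((R₁ : ℝ) * R₂))) * c₁ * c₂ := by ring

/-- `H_s` with `s` sublinear (and monotone on `[0,∞)`) ⟹ `ABC`: above the threshold `exp(s(log rad)) ≤ rad^ε`,
below it `exp(s(log rad)) ≤ exp(s(L₀))`; the constant `K · max(1, exp(s L₀)) + 1` serves both. [folklore] -/
theorem abc_of_pointwiseSlack_of_sublinear {s : ℝ → ℝ} (hs : MonotoneOn s (Set.Ici 0)) (h : PointwiseSlack s)
    (hsub : Sublinear s) : _root_.ABC := by
  obtain ⟨K, hK, h⟩ := h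
  rw [_root_.ABC_iff]
  intro ε hε
  obtain ⟨L₁, hL₁⟩ := hsub ε hε
  -- WLOG the threshold is nonnegative
  set L₀ : ℝ := max L₁ 0 with hL₀_def
  have hL₀0 : (0 : ℝ) ≤ L₀ := le_max_right _ _
  have hL₀ : ∀ L : ℝ, L₀ ≤ L → s L ≤ ε * L := fun L hL => hL₁ L ((le_max_left _ _).trans hL)
  set D : ℝ := max 1 (Real.exp (s L₀)) with hD_def
  have hD1 : 1 ≤ D := le_max_left _ _
  have hD0 : 0 < D := by linarith
  refine ⟨K * D + 1, by positivity, ?_⟩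
  intro a b c habc
  have hrad2 : (2 : ℝ) ≤ ((rad a b c : ℕ) : ℝ) := by exact_mod_cast SubmultOfRST.two_le_rad habc
  set r : ℝ := ((rad a b c : ℕ) : ℝ) with hr_def
  have hr0 : (0 : ℝ) < r := by linarith
  have hr1 : (1 : ℝ) ≤ r := by linarith
  have hlog0 : 0 ≤ Real.log r := Real.log_nonneg hr1
  -- key: `exp(s(log r)) ≤ D · r^ε`
  have hkey : Real.exp (s (Real.log r)) ≤ D * r ^ ε := by
    have hrε1 : 1 ≤ r ^ ε := Real.one_le_rpow hr1 hε.le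
    rcases le_or_gt L₀ (Real.log r) with hL | hL
    · have h1 : s (Real.log r) ≤ ε * Real.log r := hL₀ _ hL
      calc Real.exp (s (Real.log r)) ≤ Real.exp (ε * Real.log r) := Real.exp_le_exp.mpr h1
        _ = r ^ ε := by rw [Real.rpow_def_of_pos hr0, mul_comm]
        _ = 1 * r ^ ε := (one_mul _).symm
        _ ≤ D * r ^ ε := mul_le_mul_of_nonneg_right hD1 (by positivity)
    · have h1 : s (Real.log r) ≤ s L₀ :=
        hs (Set.mem_Ici.mpr hlog0) (Set.mem_Ici.mpr hL₀0) hL.le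
      calc Real.exp (s (Real.log r)) ≤ Real.exp (s L₀) := Real.exp_le_exp.mpr h1
        _ ≤ D := le_max_right _ _
        _ = D * 1 := (mul_one _).symm
        _ ≤ D * r ^ ε := mul_le_mul_of_nonneg_left hrε1 hD0.le
  have hpow : r ^ (1 + ε) = r * r ^ ε := by
    rw [Real.rpow_add hr0, Real.rpow_one]
  have hpos : 0 < r ^ (1 + ε) := Real.rpow_pos_of_pos hr0 _
  calc (c : ℝ) ≤ K * r * Real.exp (s (Real.log r)) := h a b c habc
    _ ≤ K * r * (D * r ^ ε) := mul_le_mul_of_nonneg_left hkey (by positivity)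
    _ = K * D * r ^ (1 + ε) := by rw [hpow]; ring
    _ < K * D * r ^ (1 + ε) + r ^ (1 + ε) := lt_add_of_pos_right _ hpos
    _ = (K * D + 1) * r ^ (1 + ε) := by ring

/-- Fekete-admissible and monotone on `[0,∞)` ⟹ sublinear: sandwich `L` between consecutive chain points. [folklore] -/
theorem sublinear_of_feketeAdmissible {s : ℝ → ℝ} (hs : MonotoneOn s (Set.Ici 0)) (h : FeketeAdmissible s) :
    Sublinear s := by
  obtain ⟨t₀, ht₀, hlim⟩ := h
  intro ε hε
  have hε2 : 0 < ε / 2 := by linarith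
  obtain ⟨i₀, hi₀⟩ := Filter.eventually_atTop.mp ((tendsto_order.1 hlim).2 (ε / 2) hε2)
  refine ⟨2 ^ i₀ * t₀, ?_⟩
  intro L hL
  have h2i₀ : (0 : ℝ) < 2 ^ i₀ * t₀ := by positivity
  have hL0 : 0 < L := h2i₀.trans_le hL
  -- locate `L` in the chain: `2^n t₀ ≤ L < 2^(n+1) t₀`
  have h20 : (2 : ℝ) ^ 0 ≤ 2 ^ i₀ := pow_le_pow_right₀ (by norm_num) (Nat.zero_le _)
  have hx : 1 ≤ L / t₀ := by
    rw [le_div_iff₀ ht₀, one_mul]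
    calc t₀ = 2 ^ 0 * t₀ := by simp
      _ ≤ 2 ^ i₀ * t₀ := mul_le_mul_of_nonneg_right h20 ht₀.le
      _ ≤ L := hL
  obtain ⟨n, hn1, hn2⟩ := exists_nat_pow_near hx one_lt_two
  have hL1 : L < 2 ^ (n + 1) * t₀ := by
    have := (div_lt_iff₀ ht₀).mp hn2
    linarith
  have hL2 : (2 : ℝ) ^ n * t₀ ≤ L := by
    have := (le_div_iff₀ ht₀).mp hn1
    linarith
  have hni : i₀ ≤ n + 1 := by
    by_contra hcon
    push Not at hcon
    have hpow : (2 : ℝ) ^ (n + 1) ≤ 2 ^ i₀ := pow_le_pow_right₀ (by norm_num) hcon.le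
    have : (2 : ℝ) ^ (n + 1) * t₀ ≤ 2 ^ i₀ * t₀ := mul_le_mul_of_nonneg_right hpow ht₀.le
    linarith
  have hstep := hi₀ (n + 1) hni
  have hpos : (0 : ℝ) < 2 ^ (n + 1) * t₀ := by positivity
  have hs1 : s (2 ^ (n + 1) * t₀) < ε / 2 * (2 ^ (n + 1) * t₀) := by
    rwa [div_lt_iff₀ hpos] at hstep
  calc s L ≤ s (2 ^ (n + 1) * t₀) :=
        hs (Set.mem_Ici.mpr hL0.le) (Set.mem_Ici.mpr hpos.le) hL1.le
    _ ≤ ε / 2 * (2 ^ (n + 1) * t₀) := hs1.le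
    _ = ε * (2 ^ n * t₀) := by rw [pow_succ]; ring
    _ ≤ ε * L := mul_le_mul_of_nonneg_left hL2 hε.le

/-- **The family theorem (T1 rule (a) for the whole technique class).**  For every slack the Fekete assembly can use
(monotone on `[0,∞)`, Fekete-admissible), the pointwise dominator `H_s` implies the crux `CruxSlack s` AND implies the
summit `ABC` on its own. [folklore] -/
theorem family_dominated {s : ℝ → ℝ} (hs : MonotoneOn s (Set.Ici 0)) (hadm : FeketeAdmissible s) :
    (PointwiseSlack s → CruxSlack s) ∧ (PointwiseSlack s → _root_.ABC) :=
  ⟨cruxSlack_of_pointwiseSlack hs,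
    fun h => abc_of_pointwiseSlack_of_sublinear hs h (sublinear_of_feketeAdmissible hs hadm)⟩

/-- Same, from the summable loss the Assembly literally consumes. [folklore] -/
theorem family_dominated_of_summableLoss {s : ℝ → ℝ} (hs : MonotoneOn s (Set.Ici 0)) (hsum : SummableLoss s) :
    (PointwiseSlack s → CruxSlack s) ∧ (PointwiseSlack s → _root_.ABC) :=
  family_dominated hs (feketeAdmissible_of_summableLoss hsum)

/-- The filed member: `L ↦ L^θ` is sublinear for `θ < 1`. [folklore] -/
theorem sublinear_rpow {θ : ℝ} (hθ : θ < 1) : Sublinear (fun L : ℝ => L ^ θ) := by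
  intro ε hε
  have ht : Tendsto (fun x : ℝ => x ^ (-(1 - θ))) atTop (𝓝 0) := tendsto_rpow_neg_atTop (by linarith)
  obtain ⟨L₀, hL₀⟩ := Filter.eventually_atTop.mp ((tendsto_order.1 ht).2 ε hε)
  refine ⟨max L₀ 1, fun L hL => ?_⟩
  have hL1 : (1 : ℝ) ≤ L := (le_max_right _ _).trans hL
  have hL0 : 0 < L := by linarith
  have h1 : L ^ (-(1 - θ)) < ε := hL₀ L ((le_max_left _ _).trans hL)
  have h2 : L ^ θ = L ^ (-(1 - θ)) * L := by
    conv_lhs => rw [show θ = -(1 - θ) + 1 by ring]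
    rw [Real.rpow_add hL0, Real.rpow_one]
  show L ^ θ ≤ ε * L
  rw [h2]
  exact mul_le_mul_of_nonneg_right h1.le hL0.le

/-- `L ↦ L^θ` is monotone on `[0,∞)` for `θ ≥ 0` (normal form: `θ ∈ [0,1)` suffices for the crux, tree
`ScaleSubmultiplicativity.iff_exponent_ge`). [folklore] -/
theorem monotoneOn_rpow {θ : ℝ} (hθ : 0 ≤ θ) : MonotoneOn (fun L : ℝ => L ^ θ) (Set.Ici 0) :=
  fun _ ha _ _ hab => Real.rpow_le_rpow (Set.mem_Ici.mp ha) hab hθ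

/-- Rule (a) for the filed member `s = L^θ`, `θ ∈ [0,1)`: `H_θ ⟹ crux(θ)` and `H_θ ⟹ ABC`. [folklore] -/
theorem ruleA_rpow {θ : ℝ} (hθ0 : 0 ≤ θ) (hθ1 : θ < 1) :
    (PointwiseSlack (fun L : ℝ => L ^ θ) → CruxSlack (fun L : ℝ => L ^ θ)) ∧
      (PointwiseSlack (fun L : ℝ => L ^ θ) → _root_.ABC) :=
  ⟨cruxSlack_of_pointwiseSlack (monotoneOn_rpow hθ0),
    fun h => abc_of_pointwiseSlack_of_sublinear (monotoneOn_rpow hθ0) h (sublinear_rpow hθ1)⟩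

/-! ## §2′  Zone I: linear slack is an abc-CONSEQUENCE (and Fekete-useless) -/

/-- `ABC ⟹ CruxSlack s` whenever `s(L) ≥ εL` eventually: `c < C rad^{1+ε} ≤ C (R₁R₂) e^{εL} ≤ 16 C e^{s(L)} c₁c₂`
with the dyadic witnesses.  (Generalises the landed `epsSlackSubmult_of_abc`.) [folklore] -/
theorem cruxSlack_of_abc_of_linearlyLarge {s : ℝ → ℝ} (hs : LinearlyLarge s) (hABC : _root_.ABC) :
    CruxSlack s := by
  obtain ⟨ε, hε, L₀, hL₀⟩ := hs
  obtain ⟨C, hC, hCabc⟩ := (_root_.ABC_iff.mp hABC) ε hε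
  obtain ⟨N, hN⟩ := exists_nat_ge (Real.exp L₀)
  refine ⟨16 * C, by positivity, max 4 N, ?_⟩
  intro R₁ R₂ hR₁ hR₂ a b c habc hrad
  have hR₁4 : 4 ≤ R₁ := (le_max_left _ _).trans hR₁
  have hR₂4 : 4 ≤ R₂ := (le_max_left _ _).trans hR₂
  obtain ⟨a₁, b₁, c₁, h₁, hrad₁, hc₁⟩ := SubmultOfRST.exists_triple_at_scale hR₁4
  obtain ⟨a₂, b₂, c₂, h₂, hrad₂, hc₂⟩ := SubmultOfRST.exists_triple_at_scale hR₂4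
  refine ⟨a₁, b₁, c₁, a₂, b₂, c₂, h₁, hrad₁, h₂, hrad₂, ?_⟩
  have hP16 : R₁ * R₂ < 16 * (c₁ * c₂) := by
    calc R₁ * R₂ < (4 * c₁) * (4 * c₂) := Nat.mul_lt_mul'' hc₁ hc₂
      _ = 16 * (c₁ * c₂) := by ring
  have hP16r : ((R₁ : ℝ) * R₂) ≤ 16 * ((c₁ : ℝ) * c₂) := by exact_mod_cast hP16.le
  set P : ℝ := (R₁ : ℝ) * R₂ with hP_def
  have hR₁N : (N : ℝ) ≤ (R₁ : ℝ) := by exact_mod_cast (le_max_right _ _).trans hR₁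
  have hR₂1 : (1 : ℝ) ≤ (R₂ : ℝ) := by exact_mod_cast le_trans (by norm_num) hR₂4
  have hR₁0 : (0 : ℝ) ≤ (R₁ : ℝ) := Nat.cast_nonneg _
  have hPexp : Real.exp L₀ ≤ P := by
    calc Real.exp L₀ ≤ N := hN
      _ ≤ R₁ := hR₁N
      _ = R₁ * 1 := (mul_one _).symm
      _ ≤ R₁ * R₂ := mul_le_mul_of_nonneg_left hR₂1 hR₁0
  have hP0 : 0 < P := (Real.exp_pos L₀).trans_le hPexp
  have hlogP : L₀ ≤ Real.log P := by
    have := Real.log_le_log (Real.exp_pos L₀) hPexp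
    rwa [Real.log_exp] at this
  have hsP : ε * Real.log P ≤ s (Real.log P) := hL₀ _ hlogP
  have hrad0 : (0 : ℝ) ≤ ((rad a b c : ℕ) : ℝ) := Nat.cast_nonneg _
  have hradP : ((rad a b c : ℕ) : ℝ) ≤ P := by rw [hP_def]; exact_mod_cast hrad
  have hPε : P ^ ε ≤ Real.exp (s (Real.log P)) := by
    calc P ^ ε = Real.exp (Real.log P * ε) := Real.rpow_def_of_pos hP0 ε
      _ = Real.exp (ε * Real.log P) := by rw [mul_comm]
      _ ≤ Real.exp (s (Real.log P)) := Real.exp_le_exp.mpr hsP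
  have hsplit : P ^ (1 + ε) = P * P ^ ε := by rw [Real.rpow_add hP0, Real.rpow_one]
  have hE0 : 0 ≤ Real.exp (s (Real.log P)) := (Real.exp_pos _).le
  calc (c : ℝ) ≤ C * ((rad a b c : ℕ) : ℝ) ^ (1 + ε) := (hCabc a b c habc).le
    _ ≤ C * P ^ (1 + ε) := mul_le_mul_of_nonneg_left (Real.rpow_le_rpow hrad0 hradP (by linarith)) hC.le
    _ = C * (P * P ^ ε) := by rw [hsplit]
    _ ≤ C * ((16 * ((c₁ : ℝ) * c₂)) * Real.exp (s (Real.log P))) :=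
        mul_le_mul_of_nonneg_left (mul_le_mul hP16r hPε (Real.rpow_nonneg hP0.le ε) (by positivity)) hC.le
    _ = 16 * C * Real.exp (s (Real.log P)) * c₁ * c₂ := by ring

/-- Zones I and II are disjoint. [folklore] -/
theorem not_sublinear_of_linearlyLarge {s : ℝ → ℝ} (h : LinearlyLarge s) : ¬ Sublinear s := by
  intro hsub
  obtain ⟨ε, hε, L₀, hL₀⟩ := h
  obtain ⟨L₁, hL₁⟩ := hsub (ε / 2) (by linarith)
  set L : ℝ := max (max L₀ L₁) 1 with hL_def
  have h1 : ε * L ≤ s L := hL₀ L ((le_max_left _ _).trans (le_max_left _ _))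
  have h2 : s L ≤ ε / 2 * L := hL₁ L ((le_max_right _ _).trans (le_max_left _ _))
  have hL : (1 : ℝ) ≤ L := le_max_right _ _
  nlinarith

/-! ## §2″  Zone III: below exponent 1/2 the dominator is false (Stewart–Tijdeman, landed) -/

/-- Re-export: no pointwise sub-power slack of exponent `τ < 1/2` (tree `not_subpowerSlack_of_lt_half`, from
`Literature.Barriers.ABC.EpsilonCannotBeDropped_holds`). [cite: StewartTijdeman1986, Theorem 2] -/
theorem zoneIII_tree_form : ∀ τ A : ℝ, τ < 1 / 2 → ¬ ∀ a b c : ℕ, IsABCTriple a b c →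
      (c : ℝ) < ((rad a b c : ℕ) : ℝ) * Real.exp (A * Real.log ((rad a b c : ℕ) : ℝ) ^ τ) :=
  ScaleSubmultiplicativity.not_subpowerSlack_of_lt_half

/-- The dominator of the family member `s = L^θ` is FALSE for `θ ∈ [0, 1/2)`: `K e^{L^θ} = e^{log K + L^θ} < e^{A L^θ}`
with `A = 1 + (|log K| + 1)/(log 2)^θ`, contradicting `zoneIII_tree_form`. [cite: StewartTijdeman1986, Theorem 2] -/
theorem zoneIII_dominator_false {θ : ℝ} (hθ0 : 0 ≤ θ) (hθ : θ < 1 / 2) :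
    ¬ PointwiseSlack (fun L : ℝ => L ^ θ) := by
  rintro ⟨K, hK, h⟩
  have hl2 : 0 < Real.log 2 := Real.log_pos one_lt_two
  have hc0 : 0 < Real.log 2 ^ θ := Real.rpow_pos_of_pos hl2 θ
  set A : ℝ := 1 + (|Real.log K| + 1) / Real.log 2 ^ θ with hA_def
  apply zoneIII_tree_form θ A hθ
  intro a b c habc
  have hrad2 : (2 : ℝ) ≤ ((rad a b c : ℕ) : ℝ) := by exact_mod_cast SubmultOfRST.two_le_rad habc
  set r : ℝ := ((rad a b c : ℕ) : ℝ) with hr_def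
  have hr0 : (0 : ℝ) < r := by linarith
  have hlog2 : Real.log 2 ≤ Real.log r := Real.log_le_log two_pos hrad2
  have hlog0 : 0 ≤ Real.log r := hl2.le.trans hlog2
  -- `(log 2)^θ ≤ (log r)^θ`, hence `(|log K| + 1) ≤ (|log K| + 1) (log r)^θ / (log 2)^θ`
  have hpow : Real.log 2 ^ θ ≤ Real.log r ^ θ := Real.rpow_le_rpow hl2.le hlog2 hθ0
  have hratio : (1 : ℝ) ≤ Real.log r ^ θ / Real.log 2 ^ θ := by
    rw [le_div_iff₀ hc0, one_mul]; exact hpow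
  have hK1 : 0 ≤ |Real.log K| + 1 := by positivity
  have hkey : Real.log K + Real.log r ^ θ < A * Real.log r ^ θ := by
    have hA : A * Real.log r ^ θ = Real.log r ^ θ + (|Real.log K| + 1) * (Real.log r ^ θ / Real.log 2 ^ θ) := by
      rw [hA_def]; field_simp
    rw [hA]
    have h1 : |Real.log K| + 1 ≤ (|Real.log K| + 1) * (Real.log r ^ θ / Real.log 2 ^ θ) := by
      calc |Real.log K| + 1 = (|Real.log K| + 1) * 1 := (mul_one _).symm
        _ ≤ (|Real.log K| + 1) * (Real.log r ^ θ / Real.log 2 ^ θ) := mul_le_mul_of_nonneg_left hratio hK1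
    have h2 : Real.log K < |Real.log K| + 1 := by linarith [le_abs_self (Real.log K)]
    linarith
  calc (c : ℝ) ≤ K * r * Real.exp (Real.log r ^ θ) := h a b c habc
    _ = r * Real.exp (Real.log K + Real.log r ^ θ) := by
        rw [Real.exp_add, Real.exp_log hK]; ring
    _ < r * Real.exp (A * Real.log r ^ θ) :=
        mul_lt_mul_of_pos_left (Real.exp_lt_exp.mpr hkey) hr0

/-! ## §3  The rule-(a) certificates for the filed crux (landed theorems, collected) -/

/-- The tree's sub-power slack hypothesis (inlined hypothesis of item `SubmultOfRST`, stmt-ABC-10340; implied by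
Robert–Stewart–Tenenbaum's Conjecture A, upper half, and by van Frankenhuijsen's conjectured bound). -/
def SubPower : Prop :=
  ∃ τ : ℝ, τ < 1 ∧ ∃ A : ℝ, ∀ a b c : ℕ, IsABCTriple a b c →
    (c : ℝ) < ((rad a b c : ℕ) : ℝ) * Real.exp (A * Real.log ((rad a b c : ℕ) : ℝ) ^ τ)

/-- The route item `SubmultOfRST` IS `SubPower → crux` (definitional). [folklore] -/
theorem submultOfRST_iff : SubmultOfRST ↔ (SubPower → ScaleSubmultiplicativity) := Iff.rfl

/-- **T1 rule (a), named form.**  `H := RSTConjectureAUpper` (Robert–Stewart–Tenenbaum 2014, Conjecture A (1.5);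
`@[conjecture]` in `Literature/Barriers/ABC/EpsilonCannotBeDropped.lean`) implies the crux (landed bridge
`SubmultOfRST.scaleSubmultiplicativity_of_rstConjectureAUpper`) AND implies the summit on its own (landed
`RSTConjectureAUpper.imp_abc`). [cite: RobertStewartTenenbaum2014, Conjecture A (1.5), §1] -/
theorem ruleA_rst :
    (Literature.Barriers.ABC.RSTConjectureAUpper → ScaleSubmultiplicativity) ∧
      (Literature.Barriers.ABC.RSTConjectureAUpper → _root_.ABC) :=
  ⟨SubmultOfRST.scaleSubmultiplicativity_of_rstConjectureAUpper,
    fun h => _root_.ABC_iff.mpr (Literature.Barriers.ABC.RSTConjectureAUpper.imp_abc h)⟩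

/-- **T1 rule (a), sharp form.**  `H' := SubPower` implies the crux (landed `submultOfRST_proof`, stmt-ABC-10340) AND
the summit on its own (landed `Target.abc_of_subPowerSlack`); and `H ⟹ H'`
(`SubmultOfRST.subpowerSlack_of_rstConjectureAUpper`).  With p163190
(`ScaleSubmultiplicativity.envelopeWitnesses_iff_subpowerSlack`): every certified-witness proof of the crux is a
proof of `H'`. [folklore] -/
theorem ruleA_subPower : (SubPower → ScaleSubmultiplicativity) ∧ (SubPower → _root_.ABC) ∧
    (Literature.Barriers.ABC.RSTConjectureAUpper → SubPower) :=
  ⟨fun h => submultOfRST_proof h, fun h => Target.abc_of_subPowerSlack h,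
    SubmultOfRST.subpowerSlack_of_rstConjectureAUpper⟩

/-- What any proof of the crux buys (landed, stmt-ABC-2163): polynomial abc, given Mahler/S-unit finiteness as a
hypothesis — far beyond `Literature.Barriers.ABC.BakerMethodBounds` (Stewart–Yu). [folklore] -/
theorem consequence_polynomialAbc : PolynomialAbcOfSubmult := polynomialAbcOfSubmult_proof

/-- **The NAP re-cut (s1 census R4) is dominated by the same `H`.**  `RSTConjectureAUpper ⟹ crux ⟹ NAP`
(landed `ScaleSubmultiplicativity.nap_of_scaleSubmultiplicativity`); since `NAP` is not known to follow from `ABC`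
either, T1 rule (a) fires on it verbatim. [cite: RobertStewartTenenbaum2014, Conjecture A (1.5), §1] -/
theorem ruleA_nap (h : Literature.Barriers.ABC.RSTConjectureAUpper) :
    ∃ δ₀ : ℝ, 0 < δ₀ ∧ ∃ θ : ℝ, θ < 1 ∧ ∃ K : ℝ, 0 < K ∧ ∃ R₀ : ℕ, ∀ R₁ R₂ : ℕ, R₀ ≤ R₁ → R₀ ≤ R₂ →
      ∀ l : ℝ, 1 ≤ l → l ≤ 1 + δ₀ →
      (∀ a b c : ℕ, IsABCTriple a b c → rad a b c ≤ R₁ → (c : ℝ) ≤ (R₁ : ℝ) ^ l) →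
      (∀ a b c : ℕ, IsABCTriple a b c → rad a b c ≤ R₂ → (c : ℝ) ≤ (R₂ : ℝ) ^ l) →
      ∀ a b c : ℕ, IsABCTriple a b c → rad a b c ≤ R₁ * R₂ →
        (c : ℝ) ≤ K * Real.exp (Real.log ((R₁ : ℝ) * R₂) ^ θ) * ((R₁ : ℝ) * R₂) ^ l :=
  ScaleSubmultiplicativity.nap_of_scaleSubmultiplicativity
    (SubmultOfRST.scaleSubmultiplicativity_of_rstConjectureAUpper h)

/-- Refuting the crux refutes `H` (contrapositive of `ruleA_rst.1`; = Disproof §2). [folklore] -/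
theorem not_rst_of_not_crux (h : ¬ ScaleSubmultiplicativity) : ¬ Literature.Barriers.ABC.RSTConjectureAUpper :=
  fun hR => h (ruleA_rst.1 hR)

/-! ## §4  Decomposition: SELF-SHADOWING, and where the crux actually lives

p1's census (D4) split the crux by depth in scale, `QuadraticDepthSubmult := CruxOn (rad² ≤ R₁R₂)` and its
complement, and judged the deep piece "genuinely below the summit but beyond every method" (it derived it from
fixed-exponent-2 abc).  It is in fact FREE: `rad² ≤ R₁R₂` forces `rad ≤ max(R₁,R₂)`, so the triple SHADOWS ITSELF at the
larger scale, with any triple at the other (`cruxOn_of_selfShadow`, `quadraticDepthSubmult_free`: `θ = 0`, `K = 1`,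
`R₀ = 4`).  More generally every regime with `rad ≤ max(R₁,R₂)` is free, and the crux is EQUIVALENT to its restriction to
the genuinely two-factor splits `max(R₁,R₂) < rad ≤ R₁R₂` (`scaleSubmultiplicativity_iff_genuineTwoFactor`).  The
definitions `Shadowed`, `CruxOn` and the split combinator are verbatim from `StrategySplit.lean` (seat p1), restated here
because crux workfiles are not imported from one another. -/

/-- p1's `Shadowed` (verbatim): the crux's conclusion at one split for one triple. -/
def Shadowed (θ K : ℝ) (R₁ R₂ _a _b c : ℕ) : Prop :=
  ∃ a₁ b₁ c₁ a₂ b₂ c₂ : ℕ, IsABCTriple a₁ b₁ c₁ ∧ rad a₁ b₁ c₁ ≤ R₁ ∧ IsABCTriple a₂ b₂ c₂ ∧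
    rad a₂ b₂ c₂ ≤ R₂ ∧ (c : ℝ) ≤ K * Real.exp (Real.log ((R₁ : ℝ) * R₂) ^ θ) * c₁ * c₂

/-- p1's `CruxOn Q` (verbatim): the crux restricted to the regime `Q` of splits and triples. -/
def CruxOn (Q : ℕ → ℕ → ℕ → ℕ → ℕ → Prop) : Prop :=
  ∃ θ : ℝ, θ < 1 ∧ ∃ K : ℝ, 0 < K ∧ ∃ R₀ : ℕ, ∀ R₁ R₂ : ℕ, R₀ ≤ R₁ → R₀ ≤ R₂ → ∀ a b c : ℕ,
    IsABCTriple a b c → rad a b c ≤ R₁ * R₂ → Q R₁ R₂ a b c → Shadowed θ K R₁ R₂ a b c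

/-- `CruxOn ⊤` is the crux; restriction to any regime. [folklore] -/
theorem cruxOn_of_scaleSubmultiplicativity (Q : ℕ → ℕ → ℕ → ℕ → ℕ → Prop) (h : ScaleSubmultiplicativity) :
    CruxOn Q := by
  obtain ⟨θ, hθ, K, hK, R₀, H⟩ := h
  exact ⟨θ, hθ, K, hK, R₀, fun R₁ R₂ hR₁ hR₂ a b c habc hrad _ => H R₁ R₂ hR₁ hR₂ a b c habc hrad⟩

/-- p1's split combinator (verbatim proof): `CruxOn Q ∧ CruxOn ¬Q ⟹ crux`. [folklore] -/
theorem scaleSubmultiplicativity_of_split (Q : ℕ → ℕ → ℕ → ℕ → ℕ → Prop)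
    (h₁ : CruxOn Q) (h₂ : CruxOn (fun R₁ R₂ a b c => ¬ Q R₁ R₂ a b c)) :
    ScaleSubmultiplicativity := by
  obtain ⟨θ₁, hθ₁, K₁, hK₁, S₁, H₁⟩ := h₁
  obtain ⟨θ₂, hθ₂, K₂, hK₂, S₂, H₂⟩ := h₂
  refine ⟨max θ₁ θ₂, max_lt hθ₁ hθ₂, max K₁ K₂, lt_max_of_lt_left hK₁, max (max S₁ S₂) 2, ?_⟩
  intro R₁ R₂ hR₁ hR₂ a b c habc hrad
  have hS₁R₁ : S₁ ≤ R₁ := le_trans (le_trans (le_max_left _ _) (le_max_left _ _)) hR₁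
  have hS₁R₂ : S₁ ≤ R₂ := le_trans (le_trans (le_max_left _ _) (le_max_left _ _)) hR₂
  have hS₂R₁ : S₂ ≤ R₁ := le_trans (le_trans (le_max_right _ _) (le_max_left _ _)) hR₁
  have hS₂R₂ : S₂ ≤ R₂ := le_trans (le_trans (le_max_right _ _) (le_max_left _ _)) hR₂
  have h3 : 3 ≤ R₁ * R₂ :=
    calc 3 ≤ 2 * 2 := by norm_num
      _ ≤ R₁ * R₂ := Nat.mul_le_mul (le_trans (le_max_right _ _) hR₁) (le_trans (le_max_right _ _) hR₂)
  by_cases hQ : Q R₁ R₂ a b c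
  · obtain ⟨a₁, b₁, c₁, a₂, b₂, c₂, t₁, r₁, t₂, r₂, hle⟩ := H₁ R₁ R₂ hS₁R₁ hS₁R₂ a b c habc hrad hQ
    exact ⟨a₁, b₁, c₁, a₂, b₂, c₂, t₁, r₁, t₂, r₂,
      ScaleSubmultiplicativity.bound_mono (le_max_left _ _) (le_max_left _ _) hK₁.le h3 hle⟩
  · obtain ⟨a₁, b₁, c₁, a₂, b₂, c₂, t₁, r₁, t₂, r₂, hle⟩ := H₂ R₁ R₂ hS₂R₁ hS₂R₂ a b c habc hrad hQ
    exact ⟨a₁, b₁, c₁, a₂, b₂, c₂, t₁, r₁, t₂, r₂,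
      ScaleSubmultiplicativity.bound_mono (le_max_right _ _) (le_max_right _ _) hK₂.le h3 hle⟩

/-- Every abc triple has `c ≥ 2`. [folklore] -/
theorem two_le_c {a b c : ℕ} (h : IsABCTriple a b c) : 2 ≤ c := by
  obtain ⟨ha, hb, habc, -⟩ := h
  omega

/-- **SELF-SHADOWING.**  Every regime in which the triple sits below the larger factor scale is FREE: the triple is its
own shadow there, any triple serves at the other scale (`θ = 0`, `K = 1`, `R₀ = 4`). [folklore] -/
theorem cruxOn_of_selfShadow (Q : ℕ → ℕ → ℕ → ℕ → ℕ → Prop)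
    (hQ : ∀ R₁ R₂ a b c : ℕ, IsABCTriple a b c → rad a b c ≤ R₁ * R₂ → Q R₁ R₂ a b c →
      rad a b c ≤ max R₁ R₂) :
    CruxOn Q := by
  unfold CruxOn
  refine ⟨0, one_pos, 1, one_pos, 4, ?_⟩
  intro R₁ R₂ hR₁ hR₂ a b c habc hrad hq
  unfold Shadowed
  have hmax := hQ R₁ R₂ a b c habc hrad hq
  obtain ⟨a₁, b₁, c₁, h₁, hrad₁, -⟩ := SubmultOfRST.exists_triple_at_scale hR₁
  obtain ⟨a₂, b₂, c₂, h₂, hrad₂, -⟩ := SubmultOfRST.exists_triple_at_scale hR₂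
  have hc₁ : (2 : ℝ) ≤ c₁ := by exact_mod_cast two_le_c h₁
  have hc₂ : (2 : ℝ) ≤ c₂ := by exact_mod_cast two_le_c h₂
  have hc0 : (0 : ℝ) ≤ c := Nat.cast_nonneg _
  have hslack : (1 : ℝ) ≤ 1 * Real.exp (Real.log ((R₁ : ℝ) * R₂) ^ (0 : ℝ)) := by
    rw [Real.rpow_zero, one_mul]
    exact Real.one_le_exp (by norm_num)
  rcases le_total R₁ R₂ with hle | hle
  · -- `rad ≤ R₂`: the triple shadows itself at scale `R₂`
    have hr : rad a b c ≤ R₂ := hmax.trans (max_eq_right hle).le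
    have hX : (1 : ℝ) ≤ 1 * Real.exp (Real.log ((R₁ : ℝ) * R₂) ^ (0 : ℝ)) * c₁ :=
      one_le_mul_of_one_le_of_one_le hslack (by linarith)
    refine ⟨a₁, b₁, c₁, a, b, c, h₁, hrad₁, habc, hr, ?_⟩
    calc (c : ℝ) = 1 * c := (one_mul _).symm
      _ ≤ (1 * Real.exp (Real.log ((R₁ : ℝ) * R₂) ^ (0 : ℝ)) * c₁) * c := mul_le_mul_of_nonneg_right hX hc0
  · -- `rad ≤ R₁`: the triple shadows itself at scale `R₁`
    have hr : rad a b c ≤ R₁ := hmax.trans (max_eq_left hle).le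
    have hX : (1 : ℝ) ≤ 1 * Real.exp (Real.log ((R₁ : ℝ) * R₂) ^ (0 : ℝ)) := hslack
    refine ⟨a, b, c, a₂, b₂, c₂, habc, hr, h₂, hrad₂, ?_⟩
    calc (c : ℝ) = 1 * c * 1 := by ring
      _ ≤ 1 * Real.exp (Real.log ((R₁ : ℝ) * R₂) ^ (0 : ℝ)) * c * c₂ :=
          mul_le_mul (mul_le_mul_of_nonneg_right hX hc0) (by linarith) zero_le_one (by positivity)

/-- p1's regime D4 (verbatim): the triple sits at depth `≥ 2` inside the scale. -/
def DeepInScale (R₁ R₂ a b c : ℕ) : Prop := rad a b c ^ 2 ≤ R₁ * R₂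

/-- Deep in scale ⟹ below the larger factor scale. [folklore] -/
theorem rad_le_max_of_deepInScale {R₁ R₂ a b c : ℕ} (h : DeepInScale R₁ R₂ a b c) :
    rad a b c ≤ max R₁ R₂ := by
  unfold DeepInScale at h
  rw [sq] at h
  have h2 : R₁ * R₂ ≤ max R₁ R₂ * max R₁ R₂ := Nat.mul_le_mul (le_max_left _ _) (le_max_right _ _)
  exact Nat.mul_self_le_mul_self_iff.mp (h.trans h2)

/-- **p1's D4 deep piece is a theorem** (not "polynomial-abc-hard"): `QuadraticDepthSubmult` holds outright. [folklore] -/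
theorem quadraticDepthSubmult_free : CruxOn DeepInScale :=
  cruxOn_of_selfShadow DeepInScale (fun _ _ _ _ _ _ _ hq => rad_le_max_of_deepInScale hq)

/-- Hence D4 is no split: the crux IS its shallow piece. [folklore] -/
theorem scaleSubmultiplicativity_iff_shallow :
    ScaleSubmultiplicativity ↔ CruxOn (fun R₁ R₂ a b c => ¬ DeepInScale R₁ R₂ a b c) :=
  ⟨cruxOn_of_scaleSubmultiplicativity _, fun h => scaleSubmultiplicativity_of_split DeepInScale quadraticDepthSubmult_free h⟩

/-- The genuinely two-factor splits: the triple sits above BOTH factor scales. -/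
def GenuineTwoFactor (R₁ R₂ a b c : ℕ) : Prop := max R₁ R₂ < rad a b c

/-- **Localization.**  The crux is equivalent to its restriction to the genuinely two-factor splits
`max(R₁,R₂) < rad ≤ R₁R₂`; everything else is self-shadowed. [folklore] -/
theorem scaleSubmultiplicativity_iff_genuineTwoFactor :
    ScaleSubmultiplicativity ↔ CruxOn GenuineTwoFactor := by
  refine ⟨cruxOn_of_scaleSubmultiplicativity _, fun h => scaleSubmultiplicativity_of_split GenuineTwoFactor h ?_⟩
  exact cruxOn_of_selfShadow _ (fun R₁ R₂ a b c _ _ hq => not_lt.mp hq)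

end Summit.ABC.ABC.Cruxes.ScaleSubmultiplicativity.StrategistR1
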